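import Literature.MathematicalPhysics.QuantumFieldTheory.Balaban1983to89.Node00.BackgroundSelOfRecord
import Summits.QuantumFields.YangMills.Theorems.BalabanUVNodesK0RecordFormatNames
import Summits.QuantumFields.YangMills.Theorems.FluctuationComparisonRegPrIntLS2BetaSignedCombKill
import Literature.MathematicalPhysics.QuantumFieldTheory.Balaban1983to89.T4HierRootedGauge
import Literature.MathematicalPhysics.QuantumFieldTheory.Balaban1983to89.B9TaxiTransportLadder

/-!
# PORT PT-B (U8), g2 file 1 — THE ROOTED GAUGE ON THE BONDS ENTERING A BLOCK CENTRE: the record's background field `recordBgField` (= `UkSel ∘ unitField`,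
# the (0.21) minimiser READ IN THE ROOTED GAUGE `T4RootedResidualGauge.rootGauge`) carries, on the bond `⟨r − e_μ, μ⟩` entering a block centre `r`, the FULL
# direction-`μ` cycle holonomy (Polyakov holonomy) of the minimiser based at `r` — kernel algebra behind the located reading «(R1ᴰ)'s 𝐔-block is read in the rooted
# gauge, not in print's Landau gauge» (PTB-1 g2 memo `ROOTED-GAUGE-DEFECT-27931.md`).  `--supports stmt-QuantumFields-27931` (helper; NOT a closer).

Cell `ym-nodeO-ideate` ∕ `ym-balaban-port`, porter `ymgap-nodeO-port-PTB-1` (gen 2), item **stmt-QuantumFields-27931** `BalabanUVNodes.PortPieceLocalityU8`.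
[I] = [Balaban1987RG1], [15] = [Balaban1985Variational], [B7] = [Balaban1985Averaging].

WHAT IS PROVED (0 `sorry`, 0 `def`, 0 `instance`, standard axioms; pure group algebra on the torus — NO estimate, NOTHING of Bałaban asserted):
* `pathHol_of_shift_eq_root` — if `x + e_μ = a` then the coordinate-ordered path holonomy from `a` aimed at `x` through ANY direction list `l` is the straight
  direction-`μ` holonomy of `steps a x μ = N − 1` steps if `μ ∈ l`, and `1` otherwise (all other segments have `0` steps).
* `rootTransporter_of_shift_eq_root`, `rootTransporter_rootOf` — the rooted transporter at such an `x` is `hol_U(r → r + (N−1)e_μ)`, and at a root it is `1`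
  (`T4HierRootedGauge.rootOf_self`, `B9TaxiTransportLadder.shift_unshift'` reused by name).
* ★ `rootGauge_of_shift_eq_root` — **`rootGauge k U ⟨x, μ⟩ = lineHol U (rootOf k x) μ (P.sitesPerDir 0)`** whenever `x.shift μ = rootOf k x`: the bond entering a
  block centre from below in direction `μ` carries the holonomy of `U` around the WHOLE direction-`μ` cycle of the torus through the centre (`shiftN_sitesPerDir`: the
  cycle closes).  Every direction `μ`, every block, every `U`; `shift_eq_rootOf_unshift_embIter` + ★ `rootGauge_below_centre`: this IS the case below EVERY centre `embIter k y`, every direction (`1 ≤ k`).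
* ★ `recordBgField_of_shift_eq_root` ∕ ★ `recordBgField_below_centre` — AT THE RECORD NAMES: for every (0.21) minimiser `U₀` over `unitField B` (`IsBackground`) with `UniqueUkOrbit` ([15] Thm 1's
  uniqueness clause, DISPLAYED as hypotheses — the TokE shape of 27931's antecedent), `recordBgField F θ k K B ⟨x, μ⟩ = lineHol U₀ (rootOf (k+1) x) μ N`: the charted
  `𝐔`-variable of (R1ᴰ)'s response on that bond is the Polyakov holonomy of THE minimiser (any representative: based loops at centres are residual-gauge invariant).
CONSEQUENCE (prose, see the memo): its `B`-derivative is the full-cycle sum of the linearised minimiser in ANY gauge (cycle sums of `dφ` vanish), which the linearised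
(0.3)-constraint summed around the coarse cycle forces to have block-cross-section average `ρ₈(bV a)` on the source column — `O(1)`, not `O(ξ)`; so the (4.4)-scaled
`𝐔`-clause `‖log 𝐔(b)‖ < α₂ξ` of `recordDom44J` gives `gauge ≳ L^{k+1}`, and (R1ᴰ) `gauge ≤ C₉e^{−δ₀dist}` cannot hold uniformly in `k` at the ROOTED `ι`.
HONEST FRAMING.  Kernel bookkeeping only; 27931 OPEN; K0⁷ NOT closed; NODE O 0∕1; COUNT 8∕28 · K 1∕4 UNMOVED; finite `𝕋⁴_{L^K}` at fixed ε — NOT continuum ∕ OS ∕ Clay;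
**the Yang–Mills mass gap (Clay) is NOT proved.**
-/

noncomputable section

namespace Summit.QuantumFields.YangMills.Theorems.PortU8

open Literature.MathematicalPhysics.QuantumFieldTheory.Balaban1983to89
open Literature.MathematicalPhysics.QuantumFieldTheory.Balaban1983to89.T4RootedResidualGauge
open Literature.MathematicalPhysics.QuantumFieldTheory.Balaban1983to89.B15Eq177GaugeInvariance (blockIter_embIter)
open Literature.MathematicalPhysics.QuantumFieldTheory.Balaban1983to89.B15DeterminingSets (embIter)
open Literature.MathematicalPhysics.QuantumFieldTheory.Balaban1983to89.B14.Eq22Determines (blockIter)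
open Summit.QuantumFields.YangMills.Theorems.FluctuationComparisonRegPrIntLS2BetaSignedCombKill (val_blockIter val_embIter)
open Literature.MathematicalPhysics.QuantumFieldTheory.Balaban1983to89.T4HierRootedGauge (rootOf_self)
open Literature.MathematicalPhysics.QuantumFieldTheory.Balaban1983to89.B9TaxiTransportLadder (shift_unshift')
open GaugeField (gaugeAct)

section RootedAlgebra

variable {P : Params} {G : Type*} [GaugeGroup G]

omit [GaugeGroup G] in
/-- If `x + e_μ = a` then the number of `+e_ν` steps from `a` to the `ν`-coordinate of `x` is `0` for `ν ≠ μ`. [cite: Balaban1985Averaging, (8) p.19 (bookkeeping)] -/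
theorem steps_of_shift_eq_of_ne {a x : Site P 0} {μ ν : Fin P.d} (hx : x.shift μ = a) (hν : ν ≠ μ) : steps a x ν = 0 := by
  unfold steps
  have : a ν = x ν := by rw [← hx]; simp [Site.shift, Function.update_of_ne hν]
  rw [this, sub_self, ZMod.val_zero]

omit [GaugeGroup G] in
/-- If `x + e_μ = a` then `steps a x μ + 1 = N` (the path from `a` aimed at `x` goes the long way round: `x = a + (N−1)e_μ`). [cite: Balaban1985Averaging, (8) p.19 (bookkeeping)] -/
theorem steps_of_shift_eq_self {a x : Site P 0} {μ : Fin P.d} (hx : x.shift μ = a) : steps a x μ + 1 = P.sitesPerDir 0 := by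
  unfold steps
  have ha : a μ = x μ + 1 := by rw [← hx]; simp [Site.shift]
  haveI : Fact (1 < P.sitesPerDir 0) := ⟨P.one_lt_sitesPerDir 0⟩
  rw [ha, show x μ - (x μ + 1) = -1 by ring, ZMod.neg_val, if_neg one_ne_zero, ZMod.val_one]
  have := P.one_lt_sitesPerDir 0
  omega

omit [GaugeGroup G] in
/-- If `x + e_μ = a` then `a + (steps a x μ)·e_μ = x`. [cite: Balaban1985Averaging, (8) p.19 (bookkeeping)] -/
theorem shiftN_steps_of_shift_eq {a x : Site P 0} {μ : Fin P.d} (hx : x.shift μ = a) : shiftN a μ (steps a x μ) = x := by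
  funext ν
  rw [shiftN_steps_apply]
  by_cases h : ν = μ
  · subst h; simp
  · rw [if_neg h, ← hx]; simp [Site.shift, Function.update_of_ne h]

/-- **Path holonomy towards the predecessor of the base point**: if `x + e_μ = a`, the coordinate-ordered path from `a` aimed at `x` through the directions of `l`
has holonomy `hol_U(a → a + (N−1)e_μ)` if `μ ∈ l` and `1` otherwise. [cite: Balaban1985Averaging, (8) p.19] -/
theorem pathHol_of_shift_eq_root (U : GaugeField P 0 G) {a x : Site P 0} {μ : Fin P.d} (hx : x.shift μ = a) :
    ∀ l : List (Fin P.d), pathHol U a x l = if μ ∈ l then lineHol U a μ (steps a x μ) else 1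
  | [] => by simp [pathHol]
  | ν :: l => by
      rw [pathHol]
      by_cases hν : ν = μ
      · subst hν
        rw [shiftN_steps_of_shift_eq hx, pathHol_self, mul_one, if_pos (List.mem_cons_self)]
      · rw [steps_of_shift_eq_of_ne hx hν, lineHol_zero, one_mul, shiftN_zero, pathHol_of_shift_eq_root U hx l]
        have hμ : ¬ μ = ν := fun h => hν h.symm
        simp [hμ]

/-- The rooted transporter at the predecessor `x = r − e_μ` of its own root `r` is the straight holonomy `hol_U(r → r + (N−1)e_μ)`.
[cite: Balaban1985Variational, (19) p.281 (bookkeeping)] -/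
theorem rootTransporter_of_shift_eq_root (k : ℕ) (U : GaugeField P 0 G) {x : Site P 0} {μ : Fin P.d} (hx : x.shift μ = rootOf k x) :
    rootTransporter k U x = lineHol U (rootOf k x) μ (steps (rootOf k x) x μ) := by
  unfold rootTransporter
  rw [pathHol_of_shift_eq_root U hx, if_pos (List.mem_finRange μ)]

/-- The rooted transporter is `1` at every root (standing range). [cite: Balaban1985Variational, (19) p.281 (bookkeeping)] -/
theorem rootTransporter_rootOf {k : ℕ} (hk : k ≤ P.m + P.K) (U : GaugeField P 0 G) (x : Site P 0) : rootTransporter k U (rootOf k x) = 1 := by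
  unfold rootTransporter
  rw [rootOf_self hk, pathHol_self]

omit [GaugeGroup G] in
/-- The direction-`μ` cycle closes after `N = sitesPerDir` steps. [cite: Balaban1987RG1, (0.1) p.251 (bookkeeping)] -/
theorem shiftN_sitesPerDir (a : Site P 0) (μ : Fin P.d) : shiftN a μ (P.sitesPerDir 0) = a := by
  funext ν
  unfold shiftN
  by_cases h : ν = μ
  · subst h; rw [Function.update_self, ZMod.natCast_self, add_zero]
  · rw [Function.update_of_ne h]

/-- ★ **THE BOND ENTERING A BLOCK CENTRE CARRIES THE FULL POLYAKOV HOLONOMY IN THE ROOTED GAUGE**: for every configuration `U`, every level `k` in the standing range,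
every direction `μ` and every fine site `x` whose successor `x + e_μ` is the root (block centre) of `x`,
`rootGauge k U ⟨x, μ⟩ = hol_U(r → r + N e_μ)` — the holonomy once around the direction-`μ` cycle of `T_η` based at `r = rootOf k x` (closed by `shiftN_sitesPerDir`).
[cite: Balaban1985Variational, (19) p.281; Balaban1985Averaging, (8) p.19] -/
theorem rootGauge_of_shift_eq_root {k : ℕ} (hk : k ≤ P.m + P.K) (U : GaugeField P 0 G) {x : Site P 0} {μ : Fin P.d} (hx : x.shift μ = rootOf k x) :
    rootGauge k U ⟨x, μ⟩ = lineHol U (rootOf k x) μ (P.sitesPerDir 0) := by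
  show rootTransporter k U x * U ⟨x, μ⟩ * (rootTransporter k U (x.shift μ))⁻¹ = _
  rw [hx, rootTransporter_rootOf hk, inv_one, mul_one, rootTransporter_of_shift_eq_root k U hx, ← steps_of_shift_eq_self (P := P) hx, lineHol_succ,
    shiftN_steps_of_shift_eq hx]

/-- The same read with the base point written as `x + e_μ`. [cite: Balaban1985Variational, (19) p.281] -/
theorem rootGauge_of_shift_eq_root' {k : ℕ} (hk : k ≤ P.m + P.K) (U : GaugeField P 0 G) {x : Site P 0} {μ : Fin P.d} (hx : x.shift μ = rootOf k x) :
    rootGauge k U ⟨x, μ⟩ = lineHol U (x.shift μ) μ (P.sitesPerDir 0) := by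
  rw [rootGauge_of_shift_eq_root hk U hx, hx]

omit [GaugeGroup G] in
/-- **THE PREDECESSOR OF A CENTRE LIES IN ITS BLOCK** (`k ≥ 1`, so the block half-width `(Lᵏ−1)/2 ≥ 1`): for `x := (embIter k y) − e_μ`, `x + e_μ = rootOf k x`.
Hence `rootGauge_of_shift_eq_root` applies below EVERY block centre, in EVERY direction. [cite: Balaban1987RG1, (0.1) pp.251–252] -/
theorem shift_eq_rootOf_unshift_embIter {k : ℕ} (hk : k ≤ P.m + P.K) (hk1 : 1 ≤ k) (y : Site P k) (μ : Fin P.d) :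
    ((embIter k y).unshift μ).shift μ = rootOf k ((embIter k y).unshift μ) := by
  rw [shift_unshift']
  have hL3 : 3 ≤ P.L ^ k := by
    have hL : 3 ≤ P.L := by
      obtain ⟨hodd, h1⟩ := P.hL
      obtain ⟨a, ha⟩ := hodd
      omega
    calc 3 ≤ P.L := hL
      _ = P.L ^ 1 := (pow_one _).symm
      _ ≤ P.L ^ k := Nat.pow_le_pow_right P.L_pos hk1
  have hpos : 0 < P.L ^ k := by omega
  have hh1 : 1 ≤ (P.L ^ k - 1) / 2 := by omega
  have hhlt : (P.L ^ k - 1) / 2 < P.L ^ k := by omega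
  haveI : Fact (1 < P.sitesPerDir 0) := ⟨P.one_lt_sitesPerDir 0⟩
  show embIter k y = embIter k (blockIter k ((embIter k y).unshift μ))
  congr 1
  funext ν
  apply ZMod.val_injective
  rw [val_blockIter hk]
  by_cases h : ν = μ
  · subst h
    have hv : (((embIter k y).unshift ν) ν).val = ((embIter k y) ν).val - 1 := by
      have h1 : (1 : ZMod (P.sitesPerDir 0)).val ≤ ((embIter k y) ν).val := by
        rw [ZMod.val_one, val_embIter hk]; omega
      simp only [Site.unshift, Function.update_self]
      rw [ZMod.val_sub h1, ZMod.val_one]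
    rw [hv, val_embIter hk, mul_comm, Nat.add_sub_assoc hh1, Nat.mul_add_div hpos, Nat.div_eq_of_lt (by omega), add_zero]
  · have hv : (((embIter k y).unshift μ) ν).val = ((embIter k y) ν).val := by
      simp only [Site.unshift, Function.update_of_ne h]
    rw [hv, val_embIter hk, mul_comm, Nat.mul_add_div hpos, Nat.div_eq_of_lt hhlt, add_zero]

/-- ★ COROLLARY: below every block centre, in every direction, the rooted gauge carries the full Polyakov holonomy based at the centre:
`rootGauge k U ⟨embIter k y − e_μ, μ⟩ = hol_U(embIter k y → once around the μ-cycle)` (`1 ≤ k ≤ m + K`). [cite: Balaban1985Variational, (19) p.281; Balaban1985Averaging, (8) p.19] -/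
theorem rootGauge_below_centre {k : ℕ} (hk : k ≤ P.m + P.K) (hk1 : 1 ≤ k) (U : GaugeField P 0 G) (y : Site P k) (μ : Fin P.d) :
    rootGauge k U ⟨(embIter k y).unshift μ, μ⟩ = lineHol U (embIter k y) μ (P.sitesPerDir 0) := by
  rw [rootGauge_of_shift_eq_root' hk U (shift_eq_rootOf_unshift_embIter hk hk1 y μ), shift_unshift']

end RootedAlgebra

section Record

open Literature.MathematicalPhysics.QuantumFieldTheory.Balaban1983to89.Node00
open Literature.MathematicalPhysics.QuantumFieldTheory.Balaban1983to89.T4Continuum (T4Family)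
open Summit.QuantumFields.YangMills.Theorems.K0RecordFormatNames

variable (F : T4Family) (θ : Stage13Params F 2)

/-- ★ **AT THE RECORD: the charted `𝐔`-variable on the bond entering a block centre is the Polyakov holonomy of THE minimiser.**  For every (0.21) minimiser `U₀`
over the charted coarse field `unitField B` (the `IsBackground` contract of `Uk`∕`UkSel`) in a unique minimal orbit ([15] Thm 1's uniqueness clause `UniqueUkOrbit`,
DISPLAYED), and every fine site `x` whose successor `x + e_μ` is the root of its `(k+1)`-block: `recordBgField F θ k K B ⟨x, μ⟩ = hol_{U₀}(r → r + N e_μ)`,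
`r = rootOf (k+1) x` — independent of the representative `U₀`.  (So the `B`-derivative of this chart variable is the full-cycle sum of the linearised minimiser, a
gauge-invariant `O(1)` quantity — NOT the `O(ξ)` the (4.4)-scaled `𝐔`-clause of `recordDom44J` measures; see the file header.)
[cite: Balaban1987RG1, (0.21) p.256, (4.4) p.281; Balaban1985Variational, Thm 1 p.279, (19) p.281] -/
theorem recordBgField_of_shift_eq_root {k K : ℕ} (hk : k + 1 ≤ (F.P K).m + (F.P K).K)
    {B : Fin (F.P K).d → Site (F.P K) (k + 1) → θ.Vβ} {U₀ : GaugeField (F.P K) 0 (SU 2)}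
    (hu : UniqueUkOrbit F 2 K (k + 1) θ.εbg (unitField F θ k K B))
    (h₀ : IsBackground (avOfRecord F 2 K) (bgReg F 2 K (k + 1) θ.εbg) (k + 1) (unitField F θ k K B) U₀)
    {x : Site (F.P K) 0} {μ : Fin (F.P K).d} (hx : x.shift μ = rootOf (k + 1) x) :
    recordBgField F θ k K B ⟨x, μ⟩ = lineHol U₀ (rootOf (k + 1) x) μ ((F.P K).sitesPerDir 0) := by
  unfold recordBgField
  rw [← rootGauge_eq_UkSel_of_isBackground hk hu h₀]
  exact rootGauge_of_shift_eq_root hk U₀ hx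

/-- ★ The same BELOW EVERY `(k+1)`-BLOCK CENTRE, unconditionally in the site: `recordBgField F θ k K B ⟨embIter (k+1) y − e_μ, μ⟩` is the Polyakov holonomy of the
minimiser `U₀` once around the direction-`μ` cycle based at the centre `embIter (k+1) y`. [cite: Balaban1987RG1, (0.21) p.256, (4.4) p.281; Balaban1985Variational, Thm 1 p.279, (19) p.281] -/
theorem recordBgField_below_centre {k K : ℕ} (hk : k + 1 ≤ (F.P K).m + (F.P K).K)
    {B : Fin (F.P K).d → Site (F.P K) (k + 1) → θ.Vβ} {U₀ : GaugeField (F.P K) 0 (SU 2)}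
    (hu : UniqueUkOrbit F 2 K (k + 1) θ.εbg (unitField F θ k K B))
    (h₀ : IsBackground (avOfRecord F 2 K) (bgReg F 2 K (k + 1) θ.εbg) (k + 1) (unitField F θ k K B) U₀)
    (y : Site (F.P K) (k + 1)) (μ : Fin (F.P K).d) :
    recordBgField F θ k K B ⟨(embIter (k + 1) y).unshift μ, μ⟩ = lineHol U₀ (embIter (k + 1) y) μ ((F.P K).sitesPerDir 0) := by
  rw [recordBgField_of_shift_eq_root F θ hk hu h₀ (shift_eq_rootOf_unshift_embIter hk (Nat.succ_pos k) y μ),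
    ← shift_eq_rootOf_unshift_embIter hk (Nat.succ_pos k) y μ, shift_unshift']

end Record

end Summit.QuantumFields.YangMills.Theorems.PortU8

end
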